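import Literature.MathematicalPhysics.KineticTheory.LangevinChainLaSalle
import Literature.MathematicalPhysics.KineticTheory.LangevinChainKernel
import Literature.Probability.Process.BrownianSkeleton
import Literature.Analysis.ODE.ForcedSmoothDependence
import HarnessLib

/-!
# The pinned chain as a smooth function of finitely many Gaussian increments of the noise

Trunk T-KINETIC (Literature/MathematicalPhysics/KineticTheory). Provefact unit for the named fact
`CuneoEckmannHairerReyBellet2018_thm213` (`LangevinSemigroup.lean`): towards the LOCAL
MINORISATION of the transition probabilities of the pinned chain near its equilibrium
(hypothesis `hloc` of `LangevinChainMinorization.lean`) by a finite-dimensional, Hörmander-free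
argument. Conditionally on the Brownian bridges, the pair of Brownian paths on `[0, 1]` is an
affine function of its dyadic skeleton `x ∈ (ℝ^{2^m})²` (`BrownianSkeleton.lean`:
`pairPath = pairRecon (pairSkel) (pairRem)`), hence so is the momentum noise path `η`, and the
solution of the chain at time `1` becomes a function of the finite-dimensional Gaussian vector
`x`, of the initial condition `z`, and of the remainder noise path `ρ ∈ C([0,1], ℝ^N)`. This file
proves that this function is `C¹` JOINTLY in the Banach parameter `(z, x, ρ)`, by the implicit
function theorem for forced integral equations of
`Literature/Analysis/ODE/ForcedSmoothDependence.lean` (`contDiffAt_forcedSolution_family`):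

* `exists_skelForcingCLM` — the forcing `g(z, x, ρ)(τ) = z + (0, η_{x,ρ}(τ))` is a continuous
  LINEAR map of `(z, x, ρ) ∈ Ω × (ℝ^{2^m})² × C(I, ℝ^N)` into `C(I, Ω)`;
* `exists_skelSol` — the solution family `S(z, x, ρ) = (τ ↦ Φ_τ(z, η_{x,ρ})) ∈ C(I, Ω)`
  (the pathwise flow `OscillatorChain.chainFlow` of `LangevinChainSDE.lean`) is the UNIQUE zero of
  the parametric Robbin map `α ↦ g(z,x,ρ) + ∫₀ Y∘α - α` and is `C^n` for every `n`;
* `skelSol_zero` — at the zero parameter the solution is the equilibrium path `0`;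
* `exists_remNoise`, `solMap_one_eq_skelSol` — for the Brownian pair `ω`, with skeleton
  `x = pairSkel m ω` and remainder noise `ρ_ω(τ) = (c_L R¹_τ(ω) e_0 + c_R R²_τ(ω) e_{N-1})`,
  `R = pairRem m ω`, the SDE solution map satisfies `Φ_1(z, B(ω)) = S(z, x, ρ_ω)(1)`.

The noise path of the parameters is `η_{x,ρ}(t)_i = ρ(t̄)_i + [i=0] c_L PL^m_{x₁}(t⁺) +
[i=N-1] c_R PL^m_{x₂}(t⁺)` (`t̄` the projection of `t` to `[0,1]`, `PL^m` the piecewise-linear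
interpolation of `BrownianSkeleton.lean`); it is passed as a parameter `η` together with its
defining equation `hη`, and likewise `g`, `S`, `ρ` — the final minorisation theorem instantiates
them (no new definitions are introduced).

## References

* N. Cuneo, J.-P. Eckmann, M. Hairer, L. Rey-Bellet, EJP 23 (2018) no. 55, Prop. 3.6 (proof).
* J. C. Mattingly, É. Pardoux, *Malliavin calculus for the stochastic 2D Navier–Stokes equation*,
  CPAM 59 (2006) (finite-dimensional "partial Malliavin" minorisation); D. Nualart, *The
  Malliavin Calculus and Related Topics* (2006), §2.3. [folklore]
-/

noncomputable section

open MeasureTheory Filter Topology Set Metric Function unitInterval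
open scoped NNReal ContDiff

namespace Literature.MathematicalPhysics.KineticTheory.HeatConduction

open Literature.Probability.Process Literature.Analysis.ODE OscillatorChain

variable {N : ℕ}

/-! ### The noise path of a skeleton and a remainder -/

section Noise

variable (m : ℕ) (cL cR : ℝ)
  (η : PairSkeleton m → C(I, Fin N → ℝ) → ℝ → Fin N → ℝ)
  (hη : ∀ (x : PairSkeleton m) (ρ : C(I, Fin N → ℝ)) (t : ℝ) (i : Fin N),
    η x ρ t i = ρ (projIcc 0 1 zero_le_one t) i +
      ((if i.val = 0 then cL else 0) * plInterp m x.1 t.toNNReal +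
        (if i.val = N - 1 then cR else 0) * plInterp m x.2 t.toNNReal))
include hη

/-- The noise path is continuous in time. [folklore] -/
theorem continuous_skelNoise (x : PairSkeleton m) (ρ : C(I, Fin N → ℝ)) : Continuous (η x ρ) := by
  have h : η x ρ = fun t i => ρ (projIcc 0 1 zero_le_one t) i +
      ((if i.val = 0 then cL else 0) * plInterp m x.1 t.toNNReal +
        (if i.val = N - 1 then cR else 0) * plInterp m x.2 t.toNNReal) := by
    funext t i; exact hη x ρ t i
  rw [h]
  refine continuous_pi fun i => ?_
  have h1 : Continuous fun t : ℝ => ρ (projIcc 0 1 zero_le_one t) i :=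
    (continuous_apply i).comp ((map_continuous ρ).comp continuous_projIcc)
  have h2 : Continuous fun t : ℝ => plInterp m x.1 t.toNNReal :=
    (continuous_plInterp m x.1).comp continuous_real_toNNReal
  have h3 : Continuous fun t : ℝ => plInterp m x.2 t.toNNReal :=
    (continuous_plInterp m x.2).comp continuous_real_toNNReal
  exact h1.add ((continuous_const.mul h2).add (continuous_const.mul h3))

/-- The noise path is additive in `(x, ρ)`. [folklore] -/
theorem skelNoise_add (x x' : PairSkeleton m) (ρ ρ' : C(I, Fin N → ℝ)) (t : ℝ) :
    η (x + x') (ρ + ρ') t = η x ρ t + η x' ρ' t := by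
  funext i
  rw [Pi.add_apply, hη, hη, hη, Prod.fst_add, Prod.snd_add, plInterp_add, plInterp_add,
    ContinuousMap.add_apply, Pi.add_apply]
  ring

/-- The noise path is homogeneous in `(x, ρ)`. [folklore] -/
theorem skelNoise_smul (c : ℝ) (x : PairSkeleton m) (ρ : C(I, Fin N → ℝ)) (t : ℝ) :
    η (c • x) (c • ρ) t = c • η x ρ t := by
  funext i
  rw [Pi.smul_apply, hη, hη, Prod.smul_fst, Prod.smul_snd, plInterp_smul, plInterp_smul,
    ContinuousMap.smul_apply, Pi.smul_apply, smul_eq_mul, smul_eq_mul]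
  ring

/-- The zero parameter has the zero noise path. [folklore] -/
theorem skelNoise_zero : η 0 0 = 0 := by
  funext t i
  rw [hη]
  simp [plInterp]

/-- **The forcing is a continuous linear map of the parameters.** There is a continuous linear
map `g : Ω × (ℝ^{2^m})² × C(I, ℝ^N) →L C(I, Ω)` with `g(z, x, ρ)(τ) = z + (0, η_{x,ρ}(τ))`.
[folklore] -/
theorem exists_skelForcingCLM :
    ∃ g : PhaseSpace N × PairSkeleton m × C(I, Fin N → ℝ) →L[ℝ] C(I, PhaseSpace N),
      ∀ (p : PhaseSpace N × PairSkeleton m × C(I, Fin N → ℝ)) (τ : I),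
        g p τ = p.1 + ((0 : Fin N → ℝ), η p.2.1 p.2.2 τ) := by
  -- the skeleton part, a linear map from a finite-dimensional space
  let skelFun : PairSkeleton m → C(I, Fin N → ℝ) := fun x =>
    ⟨fun τ i => (if i.val = 0 then cL else 0) * plInterp m x.1 (τ : ℝ).toNNReal +
        (if i.val = N - 1 then cR else 0) * plInterp m x.2 (τ : ℝ).toNNReal, by
      refine continuous_pi fun i => ?_
      have h2 : Continuous fun τ : I => plInterp m x.1 (τ : ℝ).toNNReal :=
        (continuous_plInterp m x.1).comp (continuous_real_toNNReal.comp continuous_subtype_val)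
      have h3 : Continuous fun τ : I => plInterp m x.2 (τ : ℝ).toNNReal :=
        (continuous_plInterp m x.2).comp (continuous_real_toNNReal.comp continuous_subtype_val)
      fun_prop⟩
  let skelLM : PairSkeleton m →ₗ[ℝ] C(I, Fin N → ℝ) :=
    { toFun := skelFun
      map_add' := fun x x' => by
        ext τ i
        simp only [skelFun, ContinuousMap.coe_mk, ContinuousMap.add_apply, Pi.add_apply,
          Prod.fst_add, Prod.snd_add, plInterp_add]
        ring
      map_smul' := fun c x => by
        ext τ i
        simp only [skelFun, ContinuousMap.coe_mk, ContinuousMap.smul_apply, Pi.smul_apply,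
          Prod.smul_fst, Prod.smul_snd, plInterp_smul, smul_eq_mul, RingHom.id_apply]
        ring }
  let skelCLM : PairSkeleton m →L[ℝ] C(I, Fin N → ℝ) := LinearMap.toContinuousLinearMap skelLM
  -- the momentum embedding and the constant path
  let mom : C(I, Fin N → ℝ) →L[ℝ] C(I, PhaseSpace N) :=
    (ContinuousLinearMap.inr ℝ (Fin N → ℝ) (Fin N → ℝ)).compLeftContinuous ℝ I
  let cst : PhaseSpace N →L[ℝ] C(I, PhaseSpace N) := ContinuousLinearMap.const ℝ I
  -- assemble
  let fstP := ContinuousLinearMap.fst ℝ (PhaseSpace N) (PairSkeleton m × C(I, Fin N → ℝ))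
  let sndP := ContinuousLinearMap.snd ℝ (PhaseSpace N) (PairSkeleton m × C(I, Fin N → ℝ))
  let xP := (ContinuousLinearMap.fst ℝ (PairSkeleton m) C(I, Fin N → ℝ)).comp sndP
  let ρP := (ContinuousLinearMap.snd ℝ (PairSkeleton m) C(I, Fin N → ℝ)).comp sndP
  refine ⟨cst.comp fstP + mom.comp (skelCLM.comp xP + ρP), fun p τ => ?_⟩
  have h1 : (cst.comp fstP + mom.comp (skelCLM.comp xP + ρP)) p τ =
      p.1 + ((0 : Fin N → ℝ), skelFun p.2.1 τ + p.2.2 τ) := rfl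
  rw [h1]
  congr 1
  refine Prod.ext rfl ?_
  funext i
  show skelFun p.2.1 τ i + p.2.2 τ i = η p.2.1 p.2.2 τ i
  rw [hη]
  have hτ : projIcc 0 1 zero_le_one (τ : ℝ) = τ := projIcc_val zero_le_one τ
  rw [hτ]
  simp only [skelFun, ContinuousMap.coe_mk]
  ring

end Noise

/-! ### The solution family -/

section Solution

variable {ω₂ lam β γ : ℝ} (hω : 0 < ω₂) (hl : 0 ≤ lam) (hβ : 0 ≤ β) (hγ : 0 ≤ γ)
  (m : ℕ) (cL cR : ℝ)
  (η : PairSkeleton m → C(I, Fin N → ℝ) → ℝ → Fin N → ℝ)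
  (hη : ∀ (x : PairSkeleton m) (ρ : C(I, Fin N → ℝ)) (t : ℝ) (i : Fin N),
    η x ρ t i = ρ (projIcc 0 1 zero_le_one t) i +
      ((if i.val = 0 then cL else 0) * plInterp m x.1 t.toNNReal +
        (if i.val = N - 1 then cR else 0) * plInterp m x.2 t.toNNReal))
  (g : PhaseSpace N × PairSkeleton m × C(I, Fin N → ℝ) →L[ℝ] C(I, PhaseSpace N))
  (hg : ∀ (p : PhaseSpace N × PairSkeleton m × C(I, Fin N → ℝ)) (τ : I),
    g p τ = p.1 + ((0 : Fin N → ℝ), η p.2.1 p.2.2 τ))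
include hω hl hβ hγ hη hg

/-- **The solution family and its smoothness.** There is a map
`S : Ω × (ℝ^{2^m})² × C(I, ℝ^N) → C(I, Ω)` with `S(z, x, ρ)(τ) = Φ_τ(z, η_{x,ρ})` (the pathwise
flow of the pinned chain), which is the unique zero of the parametric Robbin map of the drift `Y`
and the forcing `g` (i.e. the unique continuous solution on `[0, 1]` of
`α(τ) = z + (0, η_{x,ρ}(τ)) + ∫₀^τ Y(α(s)) ds`), and is `C^n` jointly in `(z, x, ρ)` for every `n`.
[folklore] -/
theorem exists_skelSol (n : ℕ∞) (hn : 1 ≤ n) :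
    ∃ S : PhaseSpace N × PairSkeleton m × C(I, Fin N → ℝ) → C(I, PhaseSpace N),
      (∀ p τ, S p τ = (pinnedChain ω₂ lam β γ).chainFlow N p.1 (η p.2.1 p.2.2) τ) ∧
      (∀ p, forcedRobbinMap ((pinnedChain ω₂ lam β γ).drift N) g (p, S p) = 0) ∧
      (∀ p α, forcedRobbinMap ((pinnedChain ω₂ lam β γ).drift N) g (p, α) = 0 → α = S p) ∧
      ContDiff ℝ n S := by
  set P := pinnedChain ω₂ lam β γ with hP
  set Y := P.drift N with hY
  have hYs : ContDiff ℝ n Y := pinnedChain_contDiff_drift ω₂ lam β γ N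
  have hYc : Continuous Y := (pinnedChain_contDiff_drift ω₂ lam β γ N (n := 0)).continuous
  have hηc : ∀ x ρ, Continuous (η x ρ) := continuous_skelNoise m cL cR η hη
  -- the family
  let S : PhaseSpace N × PairSkeleton m × C(I, Fin N → ℝ) → C(I, PhaseSpace N) := fun p =>
    ⟨fun τ => P.chainFlow N p.1 (η p.2.1 p.2.2) τ,
      (pinnedChain_continuous_chainFlow hω hl hβ hγ N p.1 (hηc p.2.1 p.2.2)).comp continuous_subtype_val⟩
  have hSapply : ∀ p τ, S p τ = P.chainFlow N p.1 (η p.2.1 p.2.2) τ := fun p τ => rfl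
  -- the forcing of the integral equation is `g`
  have hforcing : ∀ (p : PhaseSpace N × PairSkeleton m × C(I, Fin N → ℝ)) (τ : I),
      forcing p.1 (η p.2.1 p.2.2) τ = g p τ := fun p τ => by rw [hg]; rfl
  -- `S p` is a zero of the Robbin map
  have hS : ∀ p, forcedRobbinMap Y g (p, S p) = 0 := by
    intro p
    rw [forcedRobbinMap_eq_zero_iff]
    intro τ
    have hsol := pinnedChain_isIntegralSolutionOn_chainFlow hω hl hβ hγ N p.1 (hηc p.2.1 p.2.2) 1 τ τ.2
    rw [hSapply, hsol, hforcing]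
    congr 1
    refine intervalIntegral.integral_congr fun s hs => ?_
    rw [uIcc_of_le τ.2.1] at hs
    have hs1 : s ∈ Icc (0 : ℝ) 1 := ⟨hs.1, hs.2.trans τ.2.2⟩
    rw [IccExtend_nemytskii_of_mem hYc (S p) hs1]
    rfl
  -- uniqueness
  have huniq : ∀ p α, forcedRobbinMap Y g (p, α) = 0 → α = S p := by
    intro p α hα
    rw [forcedRobbinMap_eq_zero_iff] at hα
    set αe : ℝ → PhaseSpace N := IccExtend zero_le_one α with hαe
    have hαc : Continuous αe := (map_continuous α).Icc_extend'
    have hsolα : IsIntegralSolutionOn Y (forcing p.1 (η p.2.1 p.2.2)) αe 1 := by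
      intro t ht
      have h1 := hα ⟨t, ht⟩
      rw [hαe, IccExtend_of_mem zero_le_one α ht, h1, ← hforcing p ⟨t, ht⟩]
      congr 1
      refine intervalIntegral.integral_congr fun s hs => ?_
      rw [uIcc_of_le ht.1] at hs
      have hs1 : s ∈ Icc (0 : ℝ) 1 := ⟨hs.1, hs.2.trans ht.2⟩
      rw [IccExtend_nemytskii_of_mem hYc α hs1, IccExtend_of_mem zero_le_one α hs1]
    have heq := pinnedChain_eqOn_chainFlow hω hl hβ hγ N p.1 (hηc p.2.1 p.2.2) hsolα hαc
    refine ContinuousMap.ext fun τ => ?_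
    have h1 := heq τ.2
    rw [hαe, IccExtend_of_mem zero_le_one α τ.2] at h1
    rw [hSapply]
    exact h1
  -- smoothness
  have hsmooth : ContDiff ℝ n S :=
    contDiff_iff_contDiffAt.2 fun p₀ => contDiffAt_forcedSolution_family hYs g.contDiff hn hS huniq p₀
  exact ⟨S, hSapply, hS, huniq, hsmooth⟩

omit hg in
/-- **At the zero parameter the solution is the equilibrium path**: `S(0) = 0` (the zero noise
path from `0 ∈ Ω` gives the zero trajectory, `0` being the equilibrium of the chain). [folklore] -/
theorem skelSol_zero {S : PhaseSpace N × PairSkeleton m × C(I, Fin N → ℝ) → C(I, PhaseSpace N)}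
    (hS : ∀ p τ, S p τ = (pinnedChain ω₂ lam β γ).chainFlow N p.1 (η p.2.1 p.2.2) τ) :
    S 0 = 0 := by
  set P := pinnedChain ω₂ lam β γ with hP
  have hη0 : η 0 0 = 0 := skelNoise_zero m cL cR η hη
  -- the zero path solves the integral equation with zero data
  have hY0 : P.drift N 0 = 0 := by
    rw [pinnedChain_drift_apply N]
    ext i
    · simp
    · simp only [Prod.snd_zero, Pi.zero_apply, mul_zero, sub_zero, neg_eq_zero, Prod.fst_zero]
      rw [P.dPotential_eq_closed]
      simp [hP, pinnedChain_deriv_U, pinnedChain_deriv_V]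
  have hsol : IsIntegralSolutionOn (P.drift N) (forcing (0 : PhaseSpace N) (0 : ℝ → Fin N → ℝ))
      (fun _ => (0 : PhaseSpace N)) 1 := by
    intro t _
    simp only [forcing, Pi.zero_apply, hY0, intervalIntegral.integral_zero, add_zero, zero_add]
    rfl
  refine ContinuousMap.ext fun τ => ?_
  rw [hS, ContinuousMap.zero_apply]
  simp only [Prod.fst_zero, Prod.snd_zero]
  rw [hη0]
  exact (pinnedChain_eqOn_chainFlow hω hl hβ hγ N (0 : PhaseSpace N) (η := 0) continuous_zero
    hsol continuous_const τ.2).symm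

end Solution

/-! ### Identification with the solution map of the SDE -/

section Identification

variable {ω₂ lam β γ : ℝ} (hω : 0 < ω₂) (hl : 0 ≤ lam) (hβ : 0 ≤ β) (hγ : 0 ≤ γ) (T_L T_R : ℝ)
  (m : ℕ)
  (η : PairSkeleton m → C(I, Fin N → ℝ) → ℝ → Fin N → ℝ)
  (hη : ∀ (x : PairSkeleton m) (ρ : C(I, Fin N → ℝ)) (t : ℝ) (i : Fin N),
    η x ρ t i = ρ (projIcc 0 1 zero_le_one t) i +
      ((if i.val = 0 then Real.sqrt (2 * γ * T_L) else 0) * plInterp m x.1 t.toNNReal +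
        (if i.val = N - 1 then Real.sqrt (2 * γ * T_R) else 0) * plInterp m x.2 t.toNNReal))

omit hη in
/-- **The remainder noise path** of a pair of raw paths, on `[0, 1]`:
`ρ_ω(τ)_i = [i=0] c_L R¹_τ(ω) + [i=N-1] c_R R²_τ(ω)`, `R = pairRem m ω` (continuous in `τ`).
[folklore] -/
theorem exists_remNoise (cL cR : ℝ) :
    ∃ ρ : WienerPair → C(I, Fin N → ℝ), ∀ (w : WienerPair) (τ : I) (i : Fin N),
      ρ w τ i = (if i.val = 0 then cL else 0) * (pairRem m w).1 ⟨(τ : ℝ), τ.2.1⟩ +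
        (if i.val = N - 1 then cR else 0) * (pairRem m w).2 ⟨(τ : ℝ), τ.2.1⟩ := by
  have hc : Continuous fun τ : I => (⟨(τ : ℝ), τ.2.1⟩ : ℝ≥0) :=
    continuous_subtype_val.subtype_mk _
  refine ⟨fun w => ⟨fun τ i => (if i.val = 0 then cL else 0) * (pairRem m w).1 ⟨(τ : ℝ), τ.2.1⟩ +
      (if i.val = N - 1 then cR else 0) * (pairRem m w).2 ⟨(τ : ℝ), τ.2.1⟩, ?_⟩, fun w τ i => rfl⟩
  refine continuous_pi fun i => ?_
  have h1 : Continuous fun τ : I => (pairRem m w).1 ⟨(τ : ℝ), τ.2.1⟩ :=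
    (continuous_pairRem_fst m w).comp hc
  have h2 : Continuous fun τ : I => (pairRem m w).2 ⟨(τ : ℝ), τ.2.1⟩ :=
    (continuous_pairRem_snd m w).comp hc
  fun_prop

include hω hl hβ hγ hη in
/-- **The SDE solution at time `1` through the skeleton**: for every pair of raw paths `ω` and
every initial condition `z`, `Φ_1(z, B(ω)) = S(z, pairSkel m ω, ρ_ω)(1)` — the Brownian paths
on `[0,1]` are `PL^m(pairSkel ω) + pairRem ω` (`pairRecon_pairSkel_pairRem`), so their momentum
noise is `η_{x, ρ_ω}` there, and the flow on `[0, 1]` only sees the noise on `[0, 1]`.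
[folklore] -/
theorem solMap_one_eq_skelSol
    {S : PhaseSpace N × PairSkeleton m × C(I, Fin N → ℝ) → C(I, PhaseSpace N)}
    (hS : ∀ p τ, S p τ = (pinnedChain ω₂ lam β γ).chainFlow N p.1 (η p.2.1 p.2.2) τ)
    {ρ : WienerPair → C(I, Fin N → ℝ)}
    (hρ : ∀ (w : WienerPair) (τ : I) (i : Fin N),
      ρ w τ i = (if i.val = 0 then Real.sqrt (2 * γ * T_L) else 0) * (pairRem m w).1 ⟨(τ : ℝ), τ.2.1⟩ +
        (if i.val = N - 1 then Real.sqrt (2 * γ * T_R) else 0) * (pairRem m w).2 ⟨(τ : ℝ), τ.2.1⟩)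
    (wp : WienerPair) (z : PhaseSpace N) :
    (pinnedChain ω₂ lam β γ).solMap N T_L T_R 1 z (pairPath wp) = S (z, pairSkel m wp, ρ wp) 1 := by
  set P := pinnedChain ω₂ lam β γ with hP
  have hηc := continuous_skelNoise m _ _ η hη (pairSkel m wp) (ρ wp)
  rw [hS]
  show P.chainFlow N z (chainNoise N (Real.sqrt (2 * P.γ * T_L)) (Real.sqrt (2 * P.γ * T_R))
    (pairPath wp)) 1 = P.chainFlow N z (η (pairSkel m wp) (ρ wp)) ((1 : I) : ℝ)
  have hγP : P.γ = γ := rfl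
  rw [hγP]
  refine pinnedChain_chainFlow_congr hω hl hβ hγ N z (continuous_chainNoise _ _ _) hηc
    (T := 1) (fun t ht => ?_) ⟨zero_le_one, le_rfl⟩
  -- the two noise paths agree on `[0, 1]`
  funext i
  rw [chainNoise_pairPath, hη]
  have hproj : projIcc 0 1 zero_le_one t = ⟨t, ht⟩ := projIcc_of_mem zero_le_one ht
  rw [hproj, hρ]
  have htnn : t.toNNReal = ⟨t, ht.1⟩ := Real.toNNReal_of_nonneg ht.1
  have hB1 : brownian t.toNNReal wp.1 = plInterp m (pairSkel m wp).1 t.toNNReal + (pairRem m wp).1 ⟨t, ht.1⟩ := by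
    have h := plInterp_dyadicIncr_add_bridgeRem m (pairPath wp).1 t.toNNReal
    rw [htnn] at h ⊢
    exact h.symm
  have hB2 : brownian t.toNNReal wp.2 = plInterp m (pairSkel m wp).2 t.toNNReal + (pairRem m wp).2 ⟨t, ht.1⟩ := by
    have h := plInterp_dyadicIncr_add_bridgeRem m (pairPath wp).2 t.toNNReal
    rw [htnn] at h ⊢
    exact h.symm
  simp only [hB1, hB2]
  ring

end Identification

end Literature.MathematicalPhysics.KineticTheory.HeatConduction
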